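import Summits.KontsevichZagierPeriods.KontsevichZagierPeriods.Theses.LiftingCriteria
import Summits.KontsevichZagierPeriods.KontsevichZagierPeriods.Theorems.HurwitzMicroSectorsNormalFormPrincipleDimOneAssembly

/-!
# `DilationTransfer` for KZ-rational data of dimension `≤ 1`, arbitrary witness (crux stmt-KontsevichZagierPeriods-3572)

Support file for crux `DilationTransfer`
(`Summit.KontsevichZagierPeriods.KontsevichZagierPeriods.Theses.LiftingCriteria.DilationTransfer`,
route `LiftingCriteria`). The dimension-`≤ 1` case landed by the c1 lead
(`DilationTransferDimOne.stub_dilationTransferDimLeOne`, unconditional) needs the functional-relation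
WITNESS `Gⱼ` to have dimension `≤ 1` as well (the one-variable primitive is then forced to be Nash).
Here the witness is ARBITRARY — in fact it is used only at `ϖ = ϖ₀`, where it yields the numerical
relation `m₀ + Σ mᵢ ∫ gᵢ(ϖ₀ z) dz = 0` — at the price of asking the specialised integrands
`z ↦ gᵢ(ϖ₀ z)` to have KZ's literal rational shape `p/q` (`p, q ∈ ℚ[z]`) on the cube, which is the
shape of the route's vertex programme (`VertexKernel`: `gᵢ = pᵢ/qᵢ`, `ϖ₀ = 1/b`). The conclusion is
then a formal `ℤ`-combination of rational representations of dimensions `≤ 1` with vanishing value,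
and **Kontsevich–Zagier's Conjecture 1 in dimension `≤ 1`** — a tree THEOREM
(`PiBox.Dlog.mem_relations_of_eval_eq_zero_of_dim_le_one`, Baker's theorem `baker_holds` + Viu-Sos
compactification + normal forms, file `HurwitzMicroSectorsNormalFormPrincipleDimOneAssembly.lean`) —
makes it a relation. (The same two lines give `VertexKernel` for `nn ≤ 1` with `b₀ = 1`; that item is
not this file's.)

## References
* M. Kontsevich, D. Zagier, *Periods* (2001), §1.2 Conjecture 1.
* A. Baker, *Transcendental Number Theory* (1975), Thm. 2.1.
-/

noncomputable section

open scoped BigOperators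
open MeasureTheory Set
open Literature.NumberTheory.Transcendental
open Summit.KontsevichZagierPeriods.HurwitzMicroSectors.NormalFormPrinciple.PiBox.Dlog
  (mem_relations_of_eval_eq_zero_of_dim_le_one)

namespace Summit.KontsevichZagierPeriods.LiftingCriteria.DilationTransfer

/-- The one-point space `Fin 0 → ℝ` has volume `1`. [folklore] -/
theorem volume_univ_fin_zero : volume (Set.univ : Set (Fin 0 → ℝ)) = 1 := by
  rw [MeasureTheory.volume_pi, MeasureTheory.Measure.pi_univ]; simp

/-- **`DilationTransfer` for KZ-rational data of dimension `≤ 1`, with an arbitrary witness.** If every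
`gᵢ` has dimension `nᵢ ≤ 1` and every specialised integrand `z ↦ gᵢ(ϖ₀ z)` agrees on `[0,1]^{nᵢ}` with a
quotient `p/q` of `ℚ`-polynomials (`q ≠ 0` there), then the conclusion of the crux holds for every
functional-relation witness: the witness at `ϖ = ϖ₀` gives `m₀ + Σ mᵢ ∫ gᵢ(ϖ₀ z) dz = 0`, so
`m₀•[u] + Σ mᵢ•[rᵢ]` is a formal combination of rational representations of dimensions `≤ 1` with
value `0`, which is a relation by Conjecture 1 in dimension `≤ 1`
(`mem_relations_of_eval_eq_zero_of_dim_le_one`, from Baker's theorem).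
[cite: KontsevichZagier2001, §1.2 Conjecture 1] -/
theorem dilationTransfer_rational_dim_le_one :
    ∀ (S : ℕ) (n : Fin S → ℕ) (g : (i : Fin S) → (Fin (n i) → ℝ) → ℝ) (U : (i : Fin S) → Set (Fin (n i) → ℝ)), (∀ i, IsOpen (U i) ∧ Set.pi Set.univ (fun _ : Fin (n i) => Set.Icc (0:ℝ) 1) ⊆ (U i) ∧ Literature.NumberTheory.Transcendental.IsSemialgebraicFunOn ℚ (U i) (g i) ∧ AnalyticOnNhd ℝ (g i) (U i)) → (∀ i, n i ≤ 1) → ∀ (m : Fin S → ℤ) (m₀ : ℤ) (ϖ₀ : ℚ), 0 < ϖ₀ → ϖ₀ ≤ 1 → (∀ i, ∃ p q : MvPolynomial (Fin (n i)) ℚ, ∀ z ∈ Set.pi Set.univ (fun _ : Fin (n i) => Set.Icc (0:ℝ) 1), MvPolynomial.aeval z q ≠ 0 ∧ g i ((ϖ₀ : ℝ) • z) = MvPolynomial.aeval z p / MvPolynomial.aeval z q) → (∃ (T : ℕ) (d : Fin T → ℕ) (G : (j : Fin T) → (Fin (d j) → ℝ) → ℝ) (V : (j : Fin T) → Set (Fin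 (d j) → ℝ)) (μ : Fin T → Polynomial ℝ) (μ₀ : Polynomial ℝ), (∀ j, IsOpen (V j) ∧ Set.pi Set.univ (fun _ : Fin (d j) => Set.Icc (0:ℝ) 1) ⊆ (V j) ∧ Literature.NumberTheory.Transcendental.IsSemialgebraicFunOn ℚ (V j) (G j) ∧ AnalyticOnNhd ℝ (G j) (V j)) ∧ (∀ j k, IsAlgebraic ℚ ((μ j).coeff k)) ∧ (∀ k, IsAlgebraic ℚ (μ₀.coeff k)) ∧ ∀ ϖ ∈ Set.Icc (0:ℝ) 1, (m₀ : ℝ) + ∑ i, (m i : ℝ) * (∫ z in Set.pi Set.univ (fun _ : Fin (n i) => Set.Icc (0:ℝ) 1), g i (ϖ • z)) = (ϖ - (ϖ₀ : ℝ)) * (μ₀.eval ϖ + ∑ j, (μ j).eval ϖ * (∫ z in Set.pi Set.univ (fun _ : Fin (d j) => Set.Icc (0:ℝ) 1), G j (ϖ • z)))) → ∀ (r : (i : Fin S) → Literature.NumberTheory.Transcendental.KZ.IntegralRep (n i)) (u : Literature.NumberTheory.Transcendental.KZ.IntegralRep 0), (∀ i, (r i).domain = Set.pi Set.univ (fun _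 : Fin (n i) => Set.Icc (0:ℝ) 1) ∧ ∀ z ∈ Set.pi Set.univ (fun _ : Fin (n i) => Set.Icc (0:ℝ) 1), (r i).integrand z = g i ((ϖ₀ : ℝ) • z)) → u.domain = Set.univ → (∀ x, u.integrand x = 1) → m₀ • Literature.NumberTheory.Transcendental.KZ.of u + ∑ i, m i • Literature.NumberTheory.Transcendental.KZ.of (r i) ∈ Literature.NumberTheory.Transcendental.KZ.relations := by
  intro S n g U _hg hn m m₀ ϖ₀ hϖ0 hϖ1 hrat hfun r u hr hu1 hu2
  obtain ⟨T, d, G, V, μ, μ₀, -, -, -, hrel⟩ := hfun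
  -- the numerical relation at `ϖ₀`
  have hϖmem : ((ϖ₀ : ℚ) : ℝ) ∈ Set.Icc (0:ℝ) 1 :=
    ⟨by exact_mod_cast hϖ0.le, by exact_mod_cast hϖ1⟩
  have hnum : (m₀ : ℝ) + ∑ i, (m i : ℝ) *
      (∫ z in Set.pi Set.univ (fun _ : Fin (n i) => Set.Icc (0:ℝ) 1), g i ((ϖ₀ : ℝ) • z)) = 0 := by
    have h := hrel _ hϖmem
    rwa [sub_self, zero_mul] at h
  -- the representations are of KZ's rational shape
  have hrR : ∀ i, (r i).IsRational := by
    intro i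
    obtain ⟨p, q, hpq⟩ := hrat i
    refine ⟨p, q, fun z hz => ?_, fun z hz => ?_⟩
    · rw [(hr i).1] at hz
      exact (hpq z hz).1
    · rw [(hr i).1] at hz
      rw [(hr i).2 z hz, (hpq z hz).2]
  have huR : u.IsRational :=
    ⟨1, 1, fun x _ => by simp, fun x _ => by simp [hu2 x]⟩
  -- membership in the subgroup generated by rational representations of dimension `≤ 1`
  set Y : Set KZ.FormalRep :=
    {y : KZ.FormalRep | ∃ (k : ℕ) (N : KZ.IntegralRep k), k ≤ 1 ∧ N.IsRational ∧ y = KZ.of N} with hY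
  have hYu : KZ.of u ∈ Y := ⟨0, u, Nat.zero_le _, huR, rfl⟩
  have hYr : ∀ i, KZ.of (r i) ∈ Y := fun i => ⟨n i, r i, hn i, hrR i, rfl⟩
  have hmem : m₀ • KZ.of u + ∑ i, m i • KZ.of (r i) ∈ AddSubgroup.closure Y :=
    AddSubgroup.add_mem _ (AddSubgroup.zsmul_mem _ (AddSubgroup.subset_closure hYu) _)
      (AddSubgroup.sum_mem _ fun i _ =>
        AddSubgroup.zsmul_mem _ (AddSubgroup.subset_closure (hYr i)) _)
  -- its value is the numerical relation
  have hval_u : u.value = 1 := by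
    rw [KZ.IntegralRep.value, hu1]
    have : u.integrand = fun _ => 1 := funext hu2
    rw [this, setIntegral_const]
    simp [Measure.real, volume_univ_fin_zero]
  have hval_r : ∀ i, (r i).value =
      ∫ z in Set.pi Set.univ (fun _ : Fin (n i) => Set.Icc (0:ℝ) 1), g i ((ϖ₀ : ℝ) • z) := by
    intro i
    rw [KZ.IntegralRep.value, (hr i).1]
    exact setIntegral_congr_fun (MeasurableSet.univ_pi fun _ => measurableSet_Icc) (hr i).2
  have heval : KZ.eval (m₀ • KZ.of u + ∑ i, m i • KZ.of (r i)) = 0 := by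
    simp only [map_add, map_sum, map_zsmul, KZ.eval_of, zsmul_eq_mul, hval_u, mul_one, hval_r]
    exact hnum
  exact mem_relations_of_eval_eq_zero_of_dim_le_one hmem heval

end Summit.KontsevichZagierPeriods.LiftingCriteria.DilationTransfer
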